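import Mathlib
import Summits.AtomisticToContinuum.Crystallization.Theses.ChessboardParticlePlanes
import Summits.AtomisticToContinuum.Crystallization.Theorems.ChessboardParticlePlanesLjLaminarWindowsThickCircle
import Summits.AtomisticToContinuum.Crystallization.Theorems.ChessboardParticlePlanesLjLaminarWindowsTripleShell
import Summits.AtomisticToContinuum.Crystallization.Theorems.ChessboardParticlePlanesLjLaminarWindowsMassBound
import Summits.AtomisticToContinuum.Crystallization.Theorems.ChessboardParticlePlanesLjLaminarWindowsSparseAllSpiky
import Summits.AtomisticToContinuum.Crystallization.Theorems.ChessboardParticlePlanesLjLaminarWindowsNsfReduction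
import Summits.AtomisticToContinuum.Crystallization.Theorems.ChessboardParticlePlanesLjLaminarWindowsGlueNSF
import Summits.AtomisticToContinuum.Crystallization.Theorems.ChessboardParticlePlanesLjLaminarWindowsRemoval
import Summits.AtomisticToContinuum.Crystallization.Theorems.ChessboardParticlePlanesLjLaminarWindowsShellBound
import Summits.AtomisticToContinuum.Crystallization.Theorems.ChessboardParticlePlanesLjLaminarWindowsPathCount
import HarnessLib

/-! # The non-spiky fraction (NSF) and `LjLaminarWindows ⇐ LjLaminarity` — line `Sketch`, skeleton rev. 15
(lead c8), crux `LjLaminarWindows` (stmt-AtomisticToContinuum-6711)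

**NSF (theorem `nsf_holds`, unconditional).** For `θ ∈ (0,1)`, `R ≥ 1` there is `L₀` such that for every
`L ≥ L₀` there are `δ > 0`, `N₀` with: every finite `7/10`-separated `23/20`-connected configuration of
`N ≥ N₀` points of `ℝ³` has at least `δ N` particles whose boundary shell `L − R < |x_j − x_i| ≤ L`
holds at most `θ ·` (its closed `L`-ball) particles.  Assembled from the landed stubs of the NSF branch:
thick-circle count (`stub_thickCircle`), triple thick-sphere lemma (`stub_tripleShell`), Stage A mass
bound (`stub_massBound`), Stage B sparse contradiction (`stub_sparseAllSpiky`), reduction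
(`stub_nsfReduction`), with Bonferroni's inequality `nsf_bonferroni` proved here.

**Consequence (`LjLaminarWindows_of_laminarity`).** The crux `LjLaminarWindows` follows from a.e.
laminarity of Lennard-Jones ground states ALONE (the statement of board item stmt-AtomisticToContinuum-14293,
`LaminarSixThreeThree.LjLaminarity`, taken as the hypothesis `hLam`), by the landed glue `stub_glueNSF`
with window removal, the shell bound and the path count: the cohesion input of the crux is discharged. -/

noncomputable section

open scoped BigOperators
open Filter Topology
open Literature.MathematicalPhysics.StatisticalMechanics
open Summit.AtomisticToContinuum.Crystallization.Theorems.ChargedEnergyGapNegative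

namespace Summit.AtomisticToContinuum.Crystallization.Theorems.LjLaminarWindowsSketch

/-- **Bonferroni's second inequality for finite sets**:
`Σ_{i<m} #A_i ≤ #(⋃_{i<m} A_i) + Σ_{i<m} Σ_{j<i} #(A_i ∩ A_j)`. [folklore] -/
theorem nsf_bonferroni :
    ∀ (N m : ℕ) (A : ℕ → Finset (Fin N)),
      ∑ i ∈ Finset.range m, ((A i).card : ℝ) ≤
        (((Finset.range m).biUnion A).card : ℝ) +
          ∑ i ∈ Finset.range m, ∑ j ∈ Finset.range i, ((A i ∩ A j).card : ℝ) := by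
  intro N m A
  have key : ∀ m : ℕ, ∑ i ∈ Finset.range m, (A i).card ≤
      ((Finset.range m).biUnion A).card + ∑ i ∈ Finset.range m, ∑ j ∈ Finset.range i, (A i ∩ A j).card := by
    intro m
    induction m with
    | zero => simp
    | succ m ih =>
      rw [Finset.sum_range_succ, Finset.sum_range_succ, Finset.range_add_one, Finset.biUnion_insert]
      set U : Finset (Fin N) := (Finset.range m).biUnion A with hU
      have h1 : (A m ∪ U).card + (A m ∩ U).card = (A m).card + U.card := Finset.card_union_add_card_inter _ _
      have h2 : (A m ∩ U).card ≤ ∑ j ∈ Finset.range m, (A m ∩ A j).card := by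
        have e : A m ∩ U = (Finset.range m).biUnion fun j => A m ∩ A j := by
          rw [hU, Finset.inter_biUnion]
        rw [e]
        exact Finset.card_biUnion_le
      omega
  exact_mod_cast key m

/-- **NSF — the non-spiky fraction (unconditional).** See the module docstring. [folklore] -/
theorem nsf_holds :
    ∀ θ R : ℝ, 0 < θ → θ < 1 → 1 ≤ R → ∃ L₀ : ℝ, ∀ L : ℝ, L₀ ≤ L → ∃ δ : ℝ, 0 < δ ∧ ∃ N₀ : ℕ,
      ∀ N : ℕ, N₀ ≤ N → ∀ x : Fin N → E3,
      (∀ j k : Fin N, j ≠ k → (7 : ℝ) / 10 ≤ dist (x j) (x k)) →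
      (∀ S : Finset (Fin N), S.Nonempty → Sᶜ.Nonempty →
          ∃ p ∈ S, ∃ k ∈ Sᶜ, dist (x p) (x k) ≤ 23 / 20) →
      δ * (N : ℝ) ≤ ((Finset.univ.filter fun i : Fin N =>
        ((Finset.univ.filter fun q : Fin N =>
            L - R < dist (x q) (x i) ∧ dist (x q) (x i) ≤ L).card : ℝ) ≤
          θ * ((Finset.univ.filter fun q : Fin N => dist (x q) (x i) ≤ L).card : ℝ)).card : ℝ) :=
  stub_nsfReduction (stub_massBound stub_thickCircle nsf_bonferroni)
    (stub_sparseAllSpiky stub_thickCircle nsf_bonferroni stub_tripleShell)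

/-- **`LjLaminarWindows ⇐ LjLaminarity`.** The crux of line `Sketch` from a.e. laminarity of
Lennard-Jones ground states (hypothesis `hLam` = the statement of stmt-AtomisticToContinuum-14293) alone:
NSF, window removal, the shell bound and the path count are theorems. [folklore] -/
theorem LjLaminarWindows_of_laminarity
    (hLam : ∀ t R : ℝ, 0 < t → 0 < R → ∀ x : (N : ℕ) → (Fin N → EuclideanSpace ℝ (Fin 3)),
      (∀ N, IsGroundState lennardJones (x N)) →
      Filter.Tendsto (fun N : ℕ => (Nat.card {i : Fin N // ¬ (∃ n : EuclideanSpace ℝ (Fin 3),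
        ‖n‖ = 1 ∧ ∃ c : ℤ → ℝ, (∀ k : ℤ, c k + 3 / 4 ≤ c (k + 1)) ∧ ∀ j : Fin N,
          dist (x N j) (x N i) ≤ R → ∃ k : ℤ, |inner ℝ (x N j - x N i) n - c k| ≤ t)} : ℝ) / N)
        Filter.atTop (nhds 0)) :
    Summit.AtomisticToContinuum.Crystallization.Theses.ChessboardParticlePlanes.LjLaminarWindows :=
  stub_glueNSF hLam nsf_holds stub_windowRemoval stub_shellBound stub_pathCount

end Summit.AtomisticToContinuum.Crystallization.Theorems.LjLaminarWindowsSketch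

end
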